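import Mathlib.GroupTheory.Index
import HarnessLib

/-!
# Indices of lattices cut out by a LOCAL READOUT: `[H(L₂) : H(L₁)] = [L₂ : L₁]` under density, and `H(L) ≤ H(L′) ⇒ L ≤ L′`
# ([Milne 2005] §6 p. 75 «`V ∕ Λ ≅ V(𝔸_f) ∕ Λ̂`»; [Shimura 1971] §3.2: the `q + 1` neighbours are read at one place)

Topic `LinearAlgebra`; namespace `Literature.LinearAlgebra`.  THEOREMS ONLY (Mathlib only; no definition, no named fact, no instance, no notation, no `sorry`).
Cell `hodgecm-mathlib`, half A line L5, X-LEAF socket `stub_EHECKE`, LA5-plan (g3) organ (O-L) part 2 = FILE B (DEAL L5-#6, LA5-p02 (g3)), layer (B2):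
the ABSTRACT local-index calculus behind (L-c) «`[H(g) : Λ_a] = q`, `gK ↦ H(g)` injective» and (L-c′) «`[𝔭_{c•w}⁻¹Λ_a : Λ_a] = q²`».  `--supports
stmt-HodgeConjecture-24832`, count-neutral; HC_CM is proved only modulo the 7 printed citations until rung 0 closes; this file is generic and discharges none.

THE SHAPE.  Three additive groups: the RATIONAL space `V` (`ℚ^N`), the ADELIC space `A` (`𝔸_{ℚ,f}^N`) with `ι : V →+ A`, and the LOCAL space `E` (`F_{u₀}²`)
with a readout `θ : A →+ E` (FILE A's local coordinate of the twisted frame); an «away from `u₀`» condition `Away ≤ A`.  The lattices of the Hecke-roof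
reading all have the form
  `H(L) := ι⁻¹(Away ⊓ θ⁻¹ L)`  («integral away from `u₀`, and `u₀`-component in the local lattice `L ≤ E`»).
* §1 `comap_readout_mono` — `L ≤ L′ ⇒ H(L) ≤ H(L′)`; `mem_comap_readout_iff`.
* §2 **`relIndex_comap_readout_eq`** — for `L₁ ≤ L₂` and DENSITY «every `e ∈ L₂` is `θ(ι v)` modulo `L₁` for some `v` with `ι v ∈ Away`» (strong approximation):
  `[H(L₂) : H(L₁)] = [L₂ : L₁]` (Mathlib `AddSubgroup.relIndex`: `relIndex_comap`, `inf_relIndex_right`, `relIndex_sup_left`).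
* §3 **`le_of_comap_readout_le`**, `eq_of_comap_readout_eq` — `H(L) ≤ H(L′) ⇒ L ≤ L′` under density of `L` modulo a common sublattice `M ≤ L ⊓ L′`
  (the INJECTIVITY `H(g) = H(g′) ⇒ g𝒪² = g′𝒪²` of the Hecke neighbours, local side left to the caller).

## References
* [Milne2005ShimuraVarieties] J. S. Milne, *Introduction to Shimura varieties* (2005), §4 pp. 48–49, §6 Thm. 6.11 p. 74 and p. 75.
* [ShimuraIATAF1971] G. Shimura, *Introduction to the Arithmetic Theory of Automorphic Functions* (1971), §3.2 (Lemma 3.22–3.23).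
* [PlatonovRapinchuk1994] V. Platonov, A. Rapinchuk, *Algebraic groups and number theory* (1994), §8.1 (lattices and their localisations).

#harness_tags linear_algebra.lattices, number_theory.adeles
-/

set_option autoImplicit false

namespace Literature.LinearAlgebra

section LocalReadout

variable {V A E : Type*} [AddCommGroup V] [AddCommGroup A] [AddCommGroup E]
  (ι : V →+ A) (θ : A →+ E) (Away : AddSubgroup A)

/-! ### §1 The lattices `H(L) = ι⁻¹(Away ⊓ θ⁻¹ L)` -/

/-- Membership in `H(L)`: `ι v` is integral away and `θ (ι v) ∈ L`. [cite: Milne2005ShimuraVarieties, §4 pp. 48–49] -/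
theorem mem_comap_readout_iff (L : AddSubgroup E) (v : V) :
    v ∈ (Away ⊓ L.comap θ).comap ι ↔ ι v ∈ Away ∧ θ (ι v) ∈ L := Iff.rfl

/-- `L ≤ L′ ⇒ H(L) ≤ H(L′)`. [cite: Milne2005ShimuraVarieties, §4 pp. 48–49] -/
theorem comap_readout_mono {L L' : AddSubgroup E} (h : L ≤ L') :
    (Away ⊓ L.comap θ).comap ι ≤ (Away ⊓ L'.comap θ).comap ι :=
  AddSubgroup.comap_mono (inf_le_inf_left _ (AddSubgroup.comap_mono h))

/-! ### §2 The index is read locally -/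

/-- **`[H(L₂) : H(L₁)] = [L₂ : L₁]` UNDER DENSITY.**  If `L₁ ≤ L₂` and every `e ∈ L₂` is congruent modulo `L₁` to some `θ (ι v)` with `ι v` integral away
(strong approximation for the rational lattice), then the relative index of `H(L₁)` in `H(L₂)` equals that of `L₁` in `L₂`: with `f := θ ∘ ι`,
`H(L₁) = f⁻¹L₁ ⊓ H(L₂)`, so `[H(L₂) : H(L₁)] = [f(H(L₂)) : L₁ ∩ f(H(L₂))] = [L₁ + f(H(L₂)) : L₁] = [L₂ : L₁]`.
[cite: Milne2005ShimuraVarieties, §6 Thm. 6.11 p. 74 and p. 75] [cite: PlatonovRapinchuk1994, §8.1] -/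
theorem relIndex_comap_readout_eq {L₁ L₂ : AddSubgroup E} (h12 : L₁ ≤ L₂)
    (hdense : ∀ e ∈ L₂, ∃ v : V, ι v ∈ Away ∧ θ (ι v) - e ∈ L₁) :
    ((Away ⊓ L₁.comap θ).comap ι).relIndex ((Away ⊓ L₂.comap θ).comap ι) = L₁.relIndex L₂ := by
  -- `H(L₁) = f⁻¹ L₁ ⊓ H(L₂)`
  have hH : (Away ⊓ L₁.comap θ).comap ι = L₁.comap (θ.comp ι) ⊓ (Away ⊓ L₂.comap θ).comap ι := by
    ext v
    simp only [AddSubgroup.mem_comap, AddSubgroup.mem_inf, AddMonoidHom.coe_comp, Function.comp_apply]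
    exact ⟨fun h => ⟨h.2, h.1, h12 h.2⟩, fun h => ⟨h.2.1, h.1⟩⟩
  -- `f(H(L₂)) ≤ L₂` and `L₁ + f(H(L₂)) = L₂` (density)
  have hsup : L₁ ⊔ ((Away ⊓ L₂.comap θ).comap ι).map (θ.comp ι) = L₂ := by
    refine le_antisymm (sup_le h12 ?_) fun e he => ?_
    · rintro _ ⟨v, hv, rfl⟩
      exact ((mem_comap_readout_iff ι θ Away L₂ v).1 hv).2
    · obtain ⟨v, hvA, hv⟩ := hdense e he
      have hv₂ : θ (ι v) ∈ L₂ := by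
        have : θ (ι v) = (θ (ι v) - e) + e := (sub_add_cancel _ _).symm
        rw [this]
        exact L₂.add_mem (h12 hv) he
      refine AddSubgroup.mem_sup.2 ⟨-(θ (ι v) - e), L₁.neg_mem hv, θ (ι v), ⟨v, ⟨hvA, hv₂⟩, rfl⟩, ?_⟩
      rw [neg_sub, sub_add_cancel]
  rw [hH, AddSubgroup.inf_relIndex_right, AddSubgroup.relIndex_comap, ← AddSubgroup.relIndex_sup_left, hsup]

/-! ### §3 Injectivity: `H(L) ≤ H(L′)` forces `L ≤ L′` -/

/-- **`H(L) ≤ H(L′) ⇒ L ≤ L′`** when `L` is dense modulo a common sublattice `M ≤ L ⊓ L′` (every `e ∈ L` is `θ(ι v)` modulo `M` with `ι v` integral away):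
the local lattice is recovered from `H(L)`. [cite: Milne2005ShimuraVarieties, §6 Thm. 6.11 p. 74 and p. 75] [cite: ShimuraIATAF1971, §3.2] -/
theorem le_of_comap_readout_le {L L' M : AddSubgroup E} (hML : M ≤ L) (hML' : M ≤ L')
    (hdense : ∀ e ∈ L, ∃ v : V, ι v ∈ Away ∧ θ (ι v) - e ∈ M)
    (h : (Away ⊓ L.comap θ).comap ι ≤ (Away ⊓ L'.comap θ).comap ι) : L ≤ L' := by
  intro e he
  obtain ⟨v, hvA, hv⟩ := hdense e he
  have hvL : θ (ι v) ∈ L := by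
    have : θ (ι v) = (θ (ι v) - e) + e := (sub_add_cancel _ _).symm
    rw [this]
    exact L.add_mem (hML hv) he
  have hvL' : θ (ι v) ∈ L' := ((mem_comap_readout_iff ι θ Away L' v).1 (h ((mem_comap_readout_iff ι θ Away L v).2 ⟨hvA, hvL⟩))).2
  have : e = θ (ι v) - (θ (ι v) - e) := (sub_sub_cancel _ _).symm
  rw [this]
  exact L'.sub_mem hvL' (hML' hv)

/-- **`H(L) = H(L′) ⇒ L = L′`** when both `L` and `L′` are dense modulo a common sublattice `M ≤ L ⊓ L′` — the injectivity half of «`gK ↦ H(g)`» for the Hecke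
neighbours, abstract side. [cite: Milne2005ShimuraVarieties, §6 Thm. 6.11 p. 74 and p. 75] [cite: ShimuraIATAF1971, §3.2] -/
theorem eq_of_comap_readout_eq {L L' M : AddSubgroup E} (hML : M ≤ L) (hML' : M ≤ L')
    (hdense : ∀ e ∈ L, ∃ v : V, ι v ∈ Away ∧ θ (ι v) - e ∈ M)
    (hdense' : ∀ e ∈ L', ∃ v : V, ι v ∈ Away ∧ θ (ι v) - e ∈ M)
    (h : (Away ⊓ L.comap θ).comap ι = (Away ⊓ L'.comap θ).comap ι) : L = L' :=
  le_antisymm (le_of_comap_readout_le ι θ Away hML hML' hdense h.le) (le_of_comap_readout_le ι θ Away hML' hML hdense' h.ge)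

/-! ### §4 Density transfers downward and the index of `H(L)` over a fixed `H(L₀)` determines `L` -/

/-- Density modulo `M` implies density modulo any `M′ ≥ M`. [cite: Milne2005ShimuraVarieties, §4 pp. 48–49] -/
theorem dense_mono {L M M' : AddSubgroup E} (hMM' : M ≤ M')
    (hdense : ∀ e ∈ L, ∃ v : V, ι v ∈ Away ∧ θ (ι v) - e ∈ M) :
    ∀ e ∈ L, ∃ v : V, ι v ∈ Away ∧ θ (ι v) - e ∈ M' :=
  fun e he => (hdense e he).imp fun _ hv => ⟨hv.1, hMM' hv.2⟩

end LocalReadout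

end Literature.LinearAlgebra
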